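import Summits.ResolutionOfSingularities.ResolutionOfSingularities.Theorems.FrobeniusLadderFRationalResolutionChartHloc
import Summits.ResolutionOfSingularities.ResolutionOfSingularities.Theorems.FrobeniusLadderFRationalResolutionIsolatedGlue
import Literature.RingTheory.Flat.IdealDescent
import Mathlib.RingTheory.Flat.Localization
import HarnessLib

/-!
# Crux `FrobeniusLadder.FRationalResolution` (stmt-ResolutionOfSingularities-15317), line `redirect`,
# stub `stub_diagonalizableQuotientResolution` — brick E-k with the residue condition replaced by the
# fpqc DESCENT DATUM of the chart-side centre (ring form + assembly)

`…PrimaryCentreEtale.hloc_of_primaryBlowup_flat_chart` (✓) resolves an isolated singular point `ι 𝔭` from a flat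
finitely presented chart `B → C` carrying a regular blow-up of a `𝔔`-primary centre `J`, at the price of a TRIVIAL
residue field extension `κ(𝔭) = κ(𝔔)` (so that `J` descends, `…CentreDescent`). The honest hypothesis is weaker and
is the one every future construction of a centre at a chart point with NON-trivial residue extension (the open
`K ≠ K̄` isolated case in dimension `≥ 3`) has to verify: Grothendieck's descent datum
`J ⊗ C ⊆ C ⊗ J` in `C ⊗_B C` (fpqc descent of closed subschemes, SGA 1 VIII 1.1 / Stacks 0245; ring form in the
tree: `Literature.RingTheory.Flat.Ideal.eq_map_comap_of_map_includeLeft_le`). Under it `I := J ∩ B` satisfies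
`I C = J`, and the chain `…ChartHloc.hloc_of_flat_chart` → `…IsolatedGlue` runs unchanged:

* `exists_descended_centre_of_descent` — `𝔔ⁿ ⊆ J ⊆ 𝔔`, `𝔔 ∩ B = 𝔭`, datum ⇒ `𝔭ⁿ ⊆ I ⊆ 𝔭`, `I C = J`;
* `hloc_of_flat_chart_of_descent` — **the local resolution datum `hloc` at `ι 𝔭` from a flat finitely presented
  chart with a regular blow-up of a `𝔔`-primary centre carrying a descent datum** (no residue condition);
* **`hasResolution_of_flat_charts_of_descent`** — an integral `X` locally of finite type over any field whose
  finitely many singular points all admit such charts has a resolution of singularities.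

Honest label: plumbing + assembly (no stub closed by name); the residue-trivial E-k is the special case in which
`C ⊗_B C` has only the diagonal prime over `(𝔔, 𝔔)`. No definitions, no named facts, no sorry.
[cite: StacksProject, Tag 0245; Tag 023N] [folklore; cite: Kollar2007, §2.2]
-/

noncomputable section

-- single-problem summit: the doubled namespace component is forced
set_option linter.dupNamespace false

open CategoryTheory AlgebraicGeometry TopologicalSpace TensorProduct
open Literature.AlgebraicGeometry.Resolution

namespace Summit.ResolutionOfSingularities.ResolutionOfSingularities.Theorems.FRationalResolution.DescentDatumCentre

/-- **Descent of the chart's centre under a descent datum.** Let `B → C` be flat, `𝔔 ⊆ C` a prime over the prime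
`𝔭 ⊆ B`, and `J ⊆ C` with `𝔔ⁿ ⊆ J ⊆ 𝔔` carrying the descent datum `J ⊗ C ⊆ C ⊗ J` in `C ⊗_B C`. Then
`I := J ∩ B` satisfies `𝔭ⁿ ⊆ I ⊆ 𝔭` and `I C = J`. [cite: StacksProject, Tag 0245] -/
theorem exists_descended_centre_of_descent {B C : Type} [CommRing B] [CommRing C] [Algebra B C]
    [Module.Flat B C] (𝔭 : Ideal B) (𝔔 : Ideal C) [𝔔.IsPrime] (h𝔔 : 𝔔.comap (algebraMap B C) = 𝔭)
    (J : Ideal C) {n : ℕ} (hJ : 𝔔 ^ n ≤ J) (hJ𝔔 : J ≤ 𝔔)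
    (hdesc : J.map (Algebra.TensorProduct.includeLeft : C →ₐ[B] C ⊗[B] C) ≤
      J.map (Algebra.TensorProduct.includeRight : C →ₐ[B] C ⊗[B] C)) :
    ∃ I : Ideal B, 𝔭 ^ n ≤ I ∧ I ≤ 𝔭 ∧ I.map (algebraMap B C) = J := by
  refine ⟨J.comap (algebraMap B C), ?_, ?_,
    (Literature.RingTheory.Flat.Ideal.eq_map_comap_of_map_includeLeft_le J hdesc).symm⟩
  · -- `𝔭ⁿ C ⊆ 𝔔ⁿ ⊆ J`
    refine Ideal.le_comap_of_map_le ?_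
    rw [Ideal.map_pow]
    refine le_trans (Ideal.pow_right_mono ?_ n) hJ
    rw [Ideal.map_le_iff_le_comap, h𝔔]
  · rw [← h𝔔]
    exact Ideal.comap_mono hJ𝔔

/-- **`hloc` at an isolated singular point from a flat chart carrying a regular blow-up of a `𝔔`-primary centre
WITH A DESCENT DATUM (no residue condition).** Data: `ι : Spec B → X` affine open over `k` (`B` a domain of finite
type over `k`), `𝔭 ⊆ B` maximal `≠ 0` with `ι 𝔭` singular and all other points of `Spec B` regular; `C` a flat
finitely presented `B`-algebra, `𝔔 ⊆ C` a prime over `𝔭`, and `J ⊆ C` with `𝔔ⁿ ⊆ J ⊆ 𝔔`, descent datum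
`J ⊗ C ⊆ C ⊗ J` in `C ⊗_B C`, and `Bl_J(Spec C)` regular. Then `ι 𝔭` has an open neighbourhood `V` without
other singular points and a proper `ρ : Y → V`, `Y` regular, an isomorphism over `V ∩ Reg X` with dense preimage.
(The datum forces `𝔔` to be the only point of `Spec C` over `𝔭`; in practice `C` is a basic open piece `C_g` of an
étale chart.) [cite: StacksProject, Tag 0245] [cite: Kollar2007, §2.2] -/
theorem hloc_of_flat_chart_of_descent (k : Type) [Field k] (X : Scheme.{0}) [IsIntegral X]
    (f : X ⟶ Spec (.of k)) [LocallyOfFiniteType f]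
    {B C : Type} [CommRing B] [CommRing C] [Algebra B C] [IsDomain B] [Algebra k B] [Algebra.FiniteType k B]
    [Module.Flat B C] [Algebra.FinitePresentation B C]
    (ι : Spec (.of B) ⟶ X) [IsOpenImmersion ι] (hι : ι ≫ f = Spec.map (CommRingCat.ofHom (algebraMap k B)))
    (𝔭 : Ideal B) [h𝔭 : 𝔭.IsMaximal] (h𝔭0 : 𝔭 ≠ ⊥)
    (hsing : ι ⟨𝔭, h𝔭.isPrime⟩ ∉ Scheme.regularLocus X)
    (hregB : ∀ P : Spec (.of B), P.asIdeal ≠ 𝔭 → P ∈ Scheme.regularLocus (Spec (.of B)))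
    (𝔔 : Ideal C) [𝔔.IsPrime] (h𝔔 : 𝔔.comap (algebraMap B C) = 𝔭)
    (J : Ideal C) {n : ℕ} (hJ : 𝔔 ^ n ≤ J) (hJ𝔔 : J ≤ 𝔔)
    (hdesc : J.map (Algebra.TensorProduct.includeLeft : C →ₐ[B] C ⊗[B] C) ≤
      J.map (Algebra.TensorProduct.includeRight : C →ₐ[B] C ⊗[B] C))
    (hregJ : Scheme.IsRegular (affineBlowup J)) :
    ∃ (V : X.Opens), ι ⟨𝔭, h𝔭.isPrime⟩ ∈ V ∧
      (∀ t : X, t ∉ Scheme.regularLocus X → t ∈ V → t = ι ⟨𝔭, h𝔭.isPrime⟩) ∧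
      ∃ (Y : Scheme.{0}) (ρ : Y ⟶ V), IsProper ρ ∧ Scheme.IsRegular Y ∧
        IsIso (ρ ∣_ (V.ι ⁻¹ᵁ ⟨Scheme.regularLocus X, isOpen_regularLocus_of_locallyOfFiniteType_field f⟩)) ∧
        Dense ((ρ ⁻¹ᵁ (V.ι ⁻¹ᵁ ⟨Scheme.regularLocus X,
          isOpen_regularLocus_of_locallyOfFiniteType_field f⟩) : Y.Opens) : Set Y) := by
  haveI : IsNoetherianRing B := Algebra.FiniteType.isNoetherianRing k B
  -- descend the centre
  obtain ⟨I, hpI, hIp, hIJ⟩ := exists_descended_centre_of_descent 𝔭 𝔔 h𝔔 J hJ hJ𝔔 hdesc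
  -- `I ≠ 0` (it contains `𝔭ⁿ`, `B` a domain)
  have hI0 : I ≠ ⊥ := by
    intro h0
    have : 𝔭 ^ n = ⊥ := le_bot_iff.mp (h0 ▸ hpI)
    exact pow_ne_zero n h𝔭0 this
  -- `𝔭` lies under `𝔔`
  have h𝔭C : (⟨𝔭, h𝔭.isPrime⟩ : PrimeSpectrum B) ∈
      Set.range (PrimeSpectrum.comap (algebraMap B C)) :=
    ⟨⟨𝔔, inferInstance⟩, PrimeSpectrum.ext h𝔔⟩
  -- `Bl_{I C} = Bl_J`
  have hregC : Scheme.IsRegular (affineBlowup (I.map (algebraMap B C))) := by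
    rw [hIJ]
    exact hregJ
  have hsingB : (⟨𝔭, h𝔭.isPrime⟩ : Spec (.of B)) ∉ Scheme.regularLocus (Spec (.of B)) :=
    fun hreg => hsing ((mem_regularLocus_iff_of_flat_of_isPreimmersion ι _).mp hreg)
  exact ChartHloc.hloc_of_flat_chart k X f (C := C) ι hι 𝔭 I (IsNoetherian.noetherian I) hI0
    hpI hIp h𝔭C hregC hsingB hregB

/-- **RESOLUTION OF ISOLATED SINGULARITIES RESOLVED, ON FLAT CHARTS WITH A DESCENT DATUM, BY THE BLOW-UP OF A
`𝔪`-PRIMARY CENTRE.** Let `X` be an integral `k`-scheme locally of finite type (any field `k`) with finitely many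
singular points, each the image `ι 𝔭` of a maximal ideal `≠ 0` of an affine open `Spec B ↪ X` (`Spec B ∖ {𝔭}`
regular) carrying a flat finitely presented `B`-algebra `C`, a prime `𝔔` over `𝔭`, and a `𝔔`-primary `J`
(`𝔔ⁿ ⊆ J ⊆ 𝔔`) with descent datum `J ⊗ C ⊆ C ⊗ J` whose blow-up `Bl_J(Spec C)` is regular. Then `X` has a
resolution of singularities. [cite: StacksProject, Tag 0245] [cite: Kollar2007, §2.2] -/
theorem hasResolution_of_flat_charts_of_descent (k : Type) [Field k] (X : Scheme.{0}) [IsIntegral X]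
    (f : X ⟶ Spec (.of k)) [LocallyOfFiniteType f] (hfin : (Scheme.regularLocus X)ᶜ.Finite)
    (hchart : ∀ s : X, s ∉ Scheme.regularLocus X →
      ∃ (B C : Type) (_ : CommRing B) (_ : CommRing C) (_ : Algebra B C) (_ : IsDomain B) (_ : Algebra k B)
        (_ : Algebra.FiniteType k B) (_ : Module.Flat B C) (_ : Algebra.FinitePresentation B C)
        (ι : Spec (.of B) ⟶ X) (_ : IsOpenImmersion ι)
        (_ : ι ≫ f = Spec.map (CommRingCat.ofHom (algebraMap k B)))
        (𝔭 : Ideal B) (h𝔭 : 𝔭.IsMaximal) (_ : 𝔭 ≠ ⊥) (_ : ι ⟨𝔭, h𝔭.isPrime⟩ = s)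
        (_ : ∀ P : Spec (.of B), P.asIdeal ≠ 𝔭 → P ∈ Scheme.regularLocus (Spec (.of B)))
        (𝔔 : Ideal C) (_ : 𝔔.IsPrime) (J : Ideal C) (n : ℕ), 𝔔.comap (algebraMap B C) = 𝔭 ∧
          𝔔 ^ n ≤ J ∧ J ≤ 𝔔 ∧
          J.map (Algebra.TensorProduct.includeLeft : C →ₐ[B] C ⊗[B] C) ≤
            J.map (Algebra.TensorProduct.includeRight : C →ₐ[B] C ⊗[B] C) ∧
          Scheme.IsRegular (affineBlowup J)) :
    Scheme.HasResolution X := by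
  refine IsolatedGlue.hasResolution_of_finite_singularLocus_of_local k X f hfin fun s hs => ?_
  obtain ⟨B, C, _, _, _, _, _, _, _, _, ι, _, hι, 𝔭, h𝔭, h𝔭0, hιs, hregB, 𝔔, _, J, n, h𝔔, hJ, hJ𝔔, hdesc,
    hregJ⟩ := hchart s hs
  subst hιs
  exact hloc_of_flat_chart_of_descent k X f ι hι 𝔭 h𝔭0 hs hregB 𝔔 h𝔔 J hJ hJ𝔔 hdesc hregJ

end Summit.ResolutionOfSingularities.ResolutionOfSingularities.Theorems.FRationalResolution.DescentDatumCentre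

end
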